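import Literature.Analysis.Quadrature.GoodLatticePoints
import Literature.Analysis.Quadrature.KorobovCBC

/-!
# Component-by-component construction of lattice points with small figure of merit `R(g, N)`
# (Dick–Pillichshammer 2014, §9.4.2: formula (9.34), Algorithm 25 and Theorem 26; Joe 2004)

Let `N` be a prime.  For a lattice point `g ∈ ℤ^s` the **figure of merit**
`R(g, N) = Σ_{𝐡 ∈ C_s*(N) ∩ L_{g,N}} r(𝐡)⁻¹` (`figureOfMerit g N` of
`Literature.Analysis.Quadrature.GoodLatticePoints`; `C(N) = (-N/2, N/2] ∩ ℤ`, `r(h) = max(1, |h|)`,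
`r(𝐡) = ∏ᵢ r(hᵢ)`, `L_{g,N}` the dual lattice `dualLattice N g` of
`Literature.Analysis.Quadrature.LatticeRules`) controls the star discrepancy of the lattice point
set `P(g, N)`: by Theorem 23 of J. Dick and F. Pillichshammer, *Discrepancy theory and quasi-Monte
Carlo integration*, Chapter 9 of W. Chen, A. Srivastav, G. Travaglini (eds.), *A Panorama of
Discrepancy Theory*, LNM 2107, Springer 2014, §9.4.2 (= Niederreiter 1992, Theorem 5.6),
`D*_N(P(g, N)) ≤ s/N + R(g, N)/2`.  We formalise, with complete proofs, the three results of
§9.4.2 on `R(g, N)` itself: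

* **Formula (9.34)** (`one_add_figureOfMerit_eq_characterSum`, `figureOfMerit_eq_characterSum`):
  `R(g, N) = -1 + (1/N) Σ_{n=0}^{N-1} ∏_{i=1}^s (1 + Σ_{h ∈ C*(N)} exp(2πi h n gᵢ/N)/|h|)`,
  the `O(N² s)` formula by which `R(g, N)` is computed; the proof is the character property of
  lattice point sets ((9.26): `(1/N) Σ_n exp(2πi n 𝐡·g/N) = [𝐡 ∈ L_{g,N}]`,
  `sum_range_exp_eq_ite`).
* **Algorithm 25** (component-by-component construction; Korobov, Sloan–Reztsov, here for the
  criterion `R`): `g₁ = 1`; given `g₁, …, g_{d-1}`, choose `g_d ∈ {1, …, N-1}` minimising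
  `R((g₁, …, g_{d-1}, z), N)` over `z ∈ {1, …, N-1}`.  As for Algorithm 20 in
  `Literature.Analysis.Quadrature.KorobovCBC` we encode its output by a predicate, `IsRCBC N g`
  ("every component `g_d ∈ {1, …, N-1}` minimises the `d`-dimensional figure of merit given
  `g₁, …, g_{d-1}`"); for `d = 1` every `z ∈ {1, …, N-1}` gives `R(z, N) = 0`
  (`figureOfMerit_fin_one_eq_zero`, the first sentence of the proof of Theorem 26), so the choice
  `g₁ = 1` is a minimiser and Algorithm 25's output satisfies `IsRCBC` (`exists_isRCBC_apply_zero_eq_one`).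
* **Theorem 26** (Joe [56] = S. Joe, in: *Monte Carlo and Quasi-Monte Carlo Methods 2002*, Springer
  2004): for prime `N` and `g` constructed by Algorithm 25, for every `d`,
  `R(g^{(d)}, N) ≤ (N-1)⁻¹ (1 + S_N)^d` with `S_N = Σ_{h ∈ C*(N)} |h|⁻¹` (`harmL N`)
  (`figureOfMerit_le_of_isRCBC`).  The proof is the one printed there: split off the last component,
  `R((g', z), N) = R(g', N) + Θ(g'; z)` (`figureOfMerit_snoc`), and average `Θ` over
  `z ∈ {1, …, N-1}` — for `(𝐡', t) ∈ C_{d+1}(N)` with `t ≠ 0` the congruence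
  `t z ≡ -𝐡'·g' (mod N)` has at most one solution `z ∈ {1, …, N-1}` because `N` is prime and
  `N ∤ t` (`card_filter_dvd_le_one` of `KorobovCBC`), whence
  `Σ_{z=1}^{N-1} Θ(g'; z) ≤ S_N Σ_{𝐡' ∈ C_d(N)} r(𝐡')⁻¹ = S_N (1 + S_N)^d` (`sum_rTheta_le`, using
  `sum_centeredBox_inv_rWeight_eq` of `GoodLatticePoints`) and the induction
  `R ≤ (N-1)⁻¹ (1 + S_N)^d + (N-1)⁻¹ S_N (1 + S_N)^d = (N-1)⁻¹ (1 + S_N)^{d+1}`.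
  With `S_N < 2 log N` (`harmL_lt` of `GoodLatticePoints` = Niederreiter [76, Lemmas 1 and 2], the
  estimate quoted before Corollary 27) this gives `R(g^{(d)}, N) ≤ (N-1)⁻¹ (1 + 2 log N)^d`
  (`figureOfMerit_le_log_of_isRCBC`), i.e. `R = O(N⁻¹ (log N)^d)`, the optimal order by Theorem 24.

Deliberately NOT here: Proposition 22 / Theorem 23 (Niederreiter's Erdős–Turán–Koksma inequality for
rational point sets and the resulting discrepancy bound — the multivariate star discrepancy is not
yet in the library) and hence Corollary 27; Theorem 24 (Larcher's lower bound and the average (9.35));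
the weighted criterion `R_{n,γ}` of Joe's 2006 sequel (S. Joe, in: MCQMC 2004, Springer 2006,
Theorem 3, doi:10.1007/3-540-31186-6_12), of which Theorem 26 is the unweighted case.

References (bib keys): J. Dick, F. Pillichshammer, in: A Panorama of Discrepancy Theory, LNM 2107
(2014) 539–619, doi:10.1007/978-3-319-04696-9_9 (`DickPillichshammer2014`), §9.4.2, formula (9.34),
Algorithm 25, Theorem 26; S. Joe, *Component by component construction of rank-1 lattice rules
having O(n⁻¹(ln n)^d) star discrepancy*, in: MCQMC 2002, Springer 2004, 293–298,
doi:10.1007/978-3-642-18743-8_17 (`Joe2004`; cited in the former as [56] — the theorem numbering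
`Theorem 26` used in the tags below is Dick–Pillichshammer's); H. Niederreiter, *Random Number Generation
and Quasi-Monte Carlo Methods*, SIAM 1992 (`Niederreiter1992`), Def. 5.4, Thm. 5.6.

AI-produced formalisation (H21 engines group, seat eng-quad-1, 2026-08-20); no facts, no axioms
beyond Mathlib's, no `sorry`.
-/

open Finset Real

noncomputable section

namespace Literature.Analysis.Quadrature

/-! ### Two facts about `C(N)` -/

/-- `0 ∈ C(N)` for `N ≥ 1`. [cite: Niederreiter1992, §3.2] -/
theorem zero_mem_centeredResidues {N : ℕ} (hN : 1 ≤ N) : (0 : ℤ) ∈ centeredResidues N := by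
  rw [mem_centeredResidues]
  omega

/-- A nonzero element of `C(N)` is not divisible by `N` (`0 < |h| ≤ N/2 < N`).
[cite: Niederreiter1992, §3.2] -/
theorem not_dvd_of_mem_centeredResidues {N : ℕ} {t : ℤ} (ht : t ∈ centeredResidues N)
    (h0 : t ≠ 0) : ¬ (N : ℤ) ∣ t := by
  rw [mem_centeredResidues] at ht
  rintro ⟨k, rfl⟩
  rcases Nat.eq_zero_or_pos N with hN | hN
  · subst hN
    simp at h0
  · have hN' : (0 : ℤ) < N := by exact_mod_cast hN
    have h1 : -1 < 2 * k := by nlinarith [ht.1]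
    have h2 : 2 * k ≤ 1 := by nlinarith [ht.2]
    have hk : k = 0 := by omega
    subst hk
    simp at h0

/-! ### Sums over `C_{d+1}(N)` as iterated sums over `C_d(N) × C(N)` -/

section Snoc

variable {s : ℕ}

/-- `(𝐡', t) ∈ C_{d+1}(N) ↔ 𝐡' ∈ C_d(N) ∧ t ∈ C(N)`. [cite: Niederreiter1992, §3.2] -/
theorem snoc_mem_centeredBox_iff {N : ℕ} {h' : Fin s → ℤ} {t : ℤ} :
    (Fin.snoc h' t : Fin (s + 1) → ℤ) ∈ centeredBox (Fin (s + 1)) N ↔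
      h' ∈ centeredBox (Fin s) N ∧ t ∈ centeredResidues N := by
  rw [mem_centeredBox, mem_centeredBox, Fin.forall_fin_succ']
  simp only [Fin.snoc_castSucc, Fin.snoc_last]

/-- `C_{d+1}(N)` is the image of `C_d(N) × C(N)` under `(𝐡', t) ↦ (𝐡', t)`. [cite: Niederreiter1992, §3.2] -/
theorem centeredBox_succ_eq_image (N : ℕ) :
    centeredBox (Fin (s + 1)) N =
      (centeredBox (Fin s) N ×ˢ centeredResidues N).image
        (fun p => (Fin.snoc p.1 p.2 : Fin (s + 1) → ℤ)) := by
  ext h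
  constructor
  · intro hh
    refine mem_image.mpr ⟨(Fin.init h, h (Fin.last s)), mem_product.mpr ?_, Fin.snoc_init_self h⟩
    have hh' : (Fin.snoc (Fin.init h) (h (Fin.last s)) : Fin (s + 1) → ℤ) ∈
        centeredBox (Fin (s + 1)) N := by
      rw [Fin.snoc_init_self]
      exact hh
    exact snoc_mem_centeredBox_iff.mp hh'
  · intro hh
    obtain ⟨p, hp, rfl⟩ := mem_image.mp hh
    exact snoc_mem_centeredBox_iff.mpr (mem_product.mp hp)

/-- `Σ_{𝐡 ∈ C_{d+1}(N)} F(𝐡) = Σ_{𝐡' ∈ C_d(N)} Σ_{t ∈ C(N)} F((𝐡', t))` (plumbing for the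
product structure `C_{d+1}(N) = C_d(N) × C(N)`). [folklore] -/
private theorem sum_centeredBox_succ {M : Type*} [AddCommMonoid M] (N : ℕ) (F : (Fin (s + 1) → ℤ) → M) :
    ∑ h ∈ centeredBox (Fin (s + 1)) N, F h =
      ∑ h' ∈ centeredBox (Fin s) N, ∑ t ∈ centeredResidues N, F (Fin.snoc h' t) := by
  rw [centeredBox_succ_eq_image, sum_image, sum_product]
  intro p _ q _ he
  obtain ⟨h1, h2⟩ := Fin.snoc_injective2 he
  exact Prod.ext h1 h2

/-- `r((𝐡', t)) = r(𝐡') · r(t)`. [cite: Niederreiter1992, §5.1] -/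
theorem rWeight_snoc (h' : Fin s → ℤ) (t : ℤ) :
    rWeight (Fin.snoc h' t : Fin (s + 1) → ℤ) = rWeight h' * max 1 |(t : ℝ)| := by
  rw [rWeight, Fin.prod_univ_castSucc]
  simp only [rWeight, Fin.snoc_castSucc, Fin.snoc_last]

/-- `(𝐡', 0) = 0 ↔ 𝐡' = 0`. [folklore] -/
private theorem snoc_zero_eq_zero_iff' (h' : Fin s → ℤ) :
    (Fin.snoc h' 0 : Fin (s + 1) → ℤ) = 0 ↔ h' = 0 := by
  constructor
  · intro h
    funext j
    have := congrFun h (Fin.castSucc j)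
    rwa [Fin.snoc_castSucc] at this
  · rintro rfl
    funext i
    refine Fin.lastCases ?_ (fun j => ?_) i
    · simp only [Fin.snoc_last, Pi.zero_apply]
    · simp only [Fin.snoc_castSucc, Pi.zero_apply]

/-! ### Splitting off the last component: `R((g', z), N) = R(g', N) + Θ(g'; z)` -/

/-- `Θ(g'; z) = Σ_{𝐡' ∈ C_d(N)} Σ_{t ∈ C*(N), 𝐡'·g' + t z ≡ 0 (mod N)} r(𝐡')⁻¹ |t|⁻¹`: the part of
`R((g', z), N)` coming from the `𝐡 = (𝐡', t)` with last coordinate `t ≠ 0` (the second sum in the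
display "Separating out the term where `h_{d+1} = 0`" of the proof of Theorem 26).
[cite: DickPillichshammer2014, Thm. 26] -/
def rTheta (N : ℕ) (z' : Fin s → ℤ) (w : ℤ) : ℝ :=
  ∑ h' ∈ centeredBox (Fin s) N, ∑ t ∈ (centeredResidues N).filter (· ≠ 0),
    if (N : ℤ) ∣ (∑ j, h' j * z' j) + t * w then (rWeight h')⁻¹ * |(t : ℝ)|⁻¹ else 0

/-- `Θ(g'; z) ≥ 0`. [cite: DickPillichshammer2014, Thm. 26] -/
theorem rTheta_nonneg (N : ℕ) (z' : Fin s → ℤ) (w : ℤ) : 0 ≤ rTheta N z' w :=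
  sum_nonneg fun h' _ => sum_nonneg fun t _ => by
    split_ifs
    · exact mul_nonneg (inv_nonneg.mpr (rWeight_pos h').le) (inv_nonneg.mpr (abs_nonneg _))
    · exact le_rfl

/-- **Separating out the term where `h_{d+1} = 0`**: `R((g', z), N) = R(g', N) + Θ(g'; z)` for
`N ≥ 1`, since the `𝐡 = (𝐡', 0) ∈ C_{d+1}*(N) ∩ L_{(g',z),N}` are exactly the `(𝐡', 0)` with
`𝐡' ∈ C_d*(N) ∩ L_{g',N}`, and `r((𝐡', 0)) = r(𝐡')`. [cite: DickPillichshammer2014, Thm. 26] -/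
theorem figureOfMerit_snoc {N : ℕ} (hN : 1 ≤ N) (z' : Fin s → ℤ) (w : ℤ) :
    figureOfMerit (Fin.snoc z' w : Fin (s + 1) → ℤ) N = figureOfMerit z' N + rTheta N z' w := by
  classical
  have h0 : (0 : ℤ) ∈ centeredResidues N := zero_mem_centeredResidues hN
  unfold figureOfMerit rTheta
  rw [sum_filter, sum_filter, sum_centeredBox_succ, ← sum_add_distrib]
  refine sum_congr rfl fun h' _ => ?_
  rw [← add_sum_erase _ _ h0, ← filter_ne']
  congr 1
  · -- the term `t = 0`
    have e1 : ((Fin.snoc h' 0 : Fin (s + 1) → ℤ) ∈ dualLattice N (Fin.snoc z' w : Fin (s + 1) → ℤ))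
        ↔ h' ∈ dualLattice N z' := by
      rw [snoc_mem_dualLattice_snoc, zero_mul, add_zero, mem_dualLattice]
    have e2 : rWeight (Fin.snoc h' 0 : Fin (s + 1) → ℤ) = rWeight h' := by
      rw [rWeight_snoc, Int.cast_zero, abs_zero, max_eq_left (zero_le_one' ℝ), mul_one]
    simp only [ne_eq, snoc_zero_eq_zero_iff', e1, e2]
  · refine sum_congr rfl fun t ht => ?_
    have ht0 : t ≠ 0 := (mem_filter.mp ht).2
    have hne : (Fin.snoc h' t : Fin (s + 1) → ℤ) ≠ 0 := by
      intro he
      have := congrFun he (Fin.last s)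
      rw [Fin.snoc_last, Pi.zero_apply] at this
      exact ht0 this
    have h1 : (1 : ℝ) ≤ |(t : ℝ)| := by exact_mod_cast Int.one_le_abs ht0
    simp only [ne_eq, hne, not_false_eq_true, true_and, snoc_mem_dualLattice_snoc, rWeight_snoc,
      max_eq_right h1, mul_inv]

/-! ### The averaging bound `Σ_{z=1}^{N-1} Θ(g'; z) ≤ S_N (1 + S_N)^d` -/

/-- **The averaging step of the proof of Theorem 26**: for a prime `N` and any `g' ∈ ℤ^d`,
`Σ_{z=1}^{N-1} Θ(g'; z) ≤ S_N Σ_{𝐡' ∈ C_d(N)} r(𝐡')⁻¹ = S_N (1 + S_N)^d`, because for `t ∈ C*(N)`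
(so `N ∤ t`) the congruence `t z ≡ -𝐡'·g' (mod N)` has at most one solution `z ∈ {1, …, N-1}`.
[cite: DickPillichshammer2014, Thm. 26] -/
theorem sum_rTheta_le {N : ℕ} (hN : N.Prime) (z' : Fin s → ℤ) :
    ∑ w ∈ cbcCandidates N, rTheta N z' w ≤ harmL N * (1 + harmL N) ^ s := by
  classical
  have hN1 : 1 ≤ N := hN.one_lt.le
  unfold rTheta
  rw [sum_comm]
  calc ∑ h' ∈ centeredBox (Fin s) N, ∑ w ∈ cbcCandidates N,
        ∑ t ∈ (centeredResidues N).filter (· ≠ 0),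
          (if (N : ℤ) ∣ (∑ j, h' j * z' j) + t * w then (rWeight h')⁻¹ * |(t : ℝ)|⁻¹ else 0)
      = ∑ h' ∈ centeredBox (Fin s) N, ∑ t ∈ (centeredResidues N).filter (· ≠ 0),
          (#{w ∈ cbcCandidates N | (N : ℤ) ∣ (∑ j, h' j * z' j) + t * w} : ℝ) *
            ((rWeight h')⁻¹ * |(t : ℝ)|⁻¹) := by
        refine sum_congr rfl fun h' _ => ?_
        rw [sum_comm]
        refine sum_congr rfl fun t _ => ?_
        rw [← sum_filter, sum_const, nsmul_eq_mul]
    _ ≤ ∑ h' ∈ centeredBox (Fin s) N, ∑ t ∈ (centeredResidues N).filter (· ≠ 0),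
          (rWeight h')⁻¹ * |(t : ℝ)|⁻¹ := by
        refine sum_le_sum fun h' _ => sum_le_sum fun t ht => ?_
        have ht' := mem_filter.mp ht
        have hnd : ¬ (N : ℤ) ∣ t := not_dvd_of_mem_centeredResidues ht'.1 ht'.2
        have hc : (#{w ∈ cbcCandidates N | (N : ℤ) ∣ (∑ j, h' j * z' j) + t * w} : ℝ) ≤ 1 := by
          exact_mod_cast card_filter_dvd_le_one hN hnd (∑ j, h' j * z' j)
        have hpos : 0 ≤ (rWeight h')⁻¹ * |(t : ℝ)|⁻¹ :=
          mul_nonneg (inv_nonneg.mpr (rWeight_pos h').le) (inv_nonneg.mpr (abs_nonneg _))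
        calc _ ≤ (1 : ℝ) * ((rWeight h')⁻¹ * |(t : ℝ)|⁻¹) := mul_le_mul_of_nonneg_right hc hpos
          _ = _ := one_mul _
    _ = (∑ h' ∈ centeredBox (Fin s) N, (rWeight h')⁻¹) * harmL N := by
        rw [sum_mul]
        refine sum_congr rfl fun h' _ => ?_
        rw [harmL, mul_sum]
    _ = harmL N * (1 + harmL N) ^ s := by
        rw [sum_centeredBox_inv_rWeight_eq N hN1, Fintype.card_fin, mul_comm]

/-! ### Algorithm 25 (component-by-component construction for `R`) -/

/-- One step of **Algorithm 25**: given `g' = (g₁, …, g_{d-1})`, the component `z ∈ {1, …, N-1}`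
minimises `R((g', z), N)` over `{1, …, N-1}`. [cite: DickPillichshammer2014, Thm. 26] -/
def IsRCBCStep (N : ℕ) (z' : Fin s → ℤ) (w : ℤ) : Prop :=
  w ∈ cbcCandidates N ∧ ∀ w' ∈ cbcCandidates N,
    figureOfMerit (Fin.snoc z' w : Fin (s + 1) → ℤ) N ≤
      figureOfMerit (Fin.snoc z' w' : Fin (s + 1) → ℤ) N

/-- In a step of Algorithm 25 the minimiser also minimises `Θ(g'; ·)`: `Θ(g'; g_d) ≤ Θ(g'; z)` for
all `z ∈ {1, …, N-1}` (`R(g', N)` does not depend on `z`). [cite: DickPillichshammer2014, Thm. 26] -/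
theorem rTheta_le_of_isRCBCStep {N : ℕ} (hN : 1 ≤ N) {z' : Fin s → ℤ} {w : ℤ}
    (hw : IsRCBCStep N z' w) {w' : ℤ} (hw' : w' ∈ cbcCandidates N) :
    rTheta N z' w ≤ rTheta N z' w' := by
  have h := hw.2 w' hw'
  rw [figureOfMerit_snoc hN, figureOfMerit_snoc hN] at h
  linarith

end Snoc

/-- The output of **Algorithm 25**: `IsRCBC N g` says that every component `g_d ∈ {1, …, N-1}` of
`g = (g₁, …, g_s)` minimises `R((g₁, …, g_{d-1}, z), N)` over `z ∈ {1, …, N-1}` (for `d = 1` all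
choices, in particular `g₁ = 1`, are minimisers, see `isRCBCStep_zero_iff`).
[cite: DickPillichshammer2014, Thm. 26] -/
def IsRCBC (N : ℕ) : {s : ℕ} → (Fin s → ℤ) → Prop
  | 0, _ => True
  | s + 1, z => IsRCBC N (fun j : Fin s => z j.castSucc) ∧
      IsRCBCStep N (fun j : Fin s => z j.castSucc) (z (Fin.last s))

/-- `IsRCBC` in dimension `0` is trivially true. [cite: DickPillichshammer2014, Thm. 26] -/
@[simp] theorem isRCBC_zero (N : ℕ) (z : Fin 0 → ℤ) : IsRCBC N z :=
  trivial

/-- `IsRCBC` in dimension `d`: `IsRCBC` for the first `d - 1` components and a step of Algorithm 25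
for the last. [cite: DickPillichshammer2014, Thm. 26] -/
theorem isRCBC_succ_iff (N : ℕ) {s : ℕ} (z : Fin (s + 1) → ℤ) :
    IsRCBC N z ↔ IsRCBC N (fun j : Fin s => z j.castSucc) ∧
      IsRCBCStep N (fun j : Fin s => z j.castSucc) (z (Fin.last s)) :=
  Iff.rfl

/-- `IsRCBC` for `(g', z)` from `IsRCBC` for `g'` and a step of Algorithm 25.
[cite: DickPillichshammer2014, Thm. 26] -/
theorem isRCBC_snoc {N : ℕ} {s : ℕ} {z' : Fin s → ℤ} {w : ℤ}
    (hz' : IsRCBC N z') (hw : IsRCBCStep N z' w) :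
    IsRCBC N (Fin.snoc z' w : Fin (s + 1) → ℤ) := by
  rw [isRCBC_succ_iff]
  simp only [Fin.snoc_castSucc, Fin.snoc_last]
  exact ⟨hz', hw⟩

/-- Every component of a vector produced by Algorithm 25 lies in `{1, …, N-1}` (in particular it is
prime to `N`, so `P(g, N)` consists of `N` distinct points). [cite: DickPillichshammer2014, Thm. 26] -/
theorem IsRCBC.mem_cbcCandidates {N : ℕ} :
    ∀ {s : ℕ} {z : Fin s → ℤ}, IsRCBC N z → ∀ i, z i ∈ cbcCandidates N
  | 0, _, _ => fun i => i.elim0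
  | s + 1, z, hz => fun i => by
      obtain ⟨hz', hstep⟩ := hz
      refine Fin.lastCases ?_ (fun j => ?_) i
      · exact hstep.1
      · exact IsRCBC.mem_cbcCandidates hz' j

/-- **Algorithm 25 terminates**: for `N ≥ 2` an `R`-CBC vector exists in every dimension (each step
minimises over the nonempty finite set `{1, …, N-1}`). [cite: DickPillichshammer2014, Thm. 26] -/
theorem exists_isRCBC {N : ℕ} (hN : 2 ≤ N) : ∀ s : ℕ, ∃ z : Fin s → ℤ, IsRCBC N z
  | 0 => ⟨Fin.elim0, trivial⟩
  | s + 1 => by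
      obtain ⟨z', hz'⟩ := exists_isRCBC hN s
      have hne : (cbcCandidates N).Nonempty := ⟨1, by rw [mem_cbcCandidates]; omega⟩
      obtain ⟨w, hw, hmin⟩ := Finset.exists_min_image (cbcCandidates N)
        (fun w => figureOfMerit (Fin.snoc z' w : Fin (s + 1) → ℤ) N) hne
      exact ⟨Fin.snoc z' w, isRCBC_snoc hz' ⟨hw, hmin⟩⟩

/-! ### Theorem 26 (Joe) -/

/-- `R(g, N) = 0` in dimension `0` (the box `C_0(N)` consists of the zero vector only).
[cite: DickPillichshammer2014, Thm. 26] -/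
theorem figureOfMerit_fin_zero (z : Fin 0 → ℤ) (N : ℕ) : figureOfMerit z N = 0 := by
  unfold figureOfMerit
  refine sum_eq_zero fun h hh => ?_
  exact absurd (Subsingleton.elim h 0) (mem_filter.mp hh).2.1

/-- **First sentence of the proof of Theorem 26**: for a prime `N` and `g₁ ∈ {1, …, N-1}`,
`R(g₁, N) = 0` — no `h ∈ C*(N)` satisfies `h g₁ ≡ 0 (mod N)`, as `N ∤ h` and `N ∤ g₁`.
[cite: DickPillichshammer2014, Thm. 26] -/
theorem figureOfMerit_fin_one_eq_zero {N : ℕ} (hN : N.Prime) (z' : Fin 0 → ℤ) {w : ℤ}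
    (hw : w ∈ cbcCandidates N) : figureOfMerit (Fin.snoc z' w : Fin 1 → ℤ) N = 0 := by
  classical
  have hp : Prime (N : ℤ) := Nat.prime_iff_prime_int.mp hN
  have hNw : ¬ (N : ℤ) ∣ w := by
    rw [mem_cbcCandidates] at hw
    intro h
    have := Int.le_of_dvd (by omega) h
    omega
  rw [figureOfMerit_snoc hN.one_lt.le, figureOfMerit_fin_zero, zero_add]
  unfold rTheta
  refine sum_eq_zero fun h' _ => sum_eq_zero fun t ht => ?_
  have ht' := mem_filter.mp ht
  have hnd : ¬ (N : ℤ) ∣ t := not_dvd_of_mem_centeredResidues ht'.1 ht'.2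
  rw [if_neg]
  rw [Finset.univ_eq_empty, sum_empty, zero_add]
  intro hd
  rcases hp.dvd_or_dvd hd with h | h
  · exact hnd h
  · exact hNw h

/-- For the first component (`d = 1`) every `z ∈ {1, …, N-1}` is a minimiser when `N` is prime
(all give `R(z, N) = 0`), so step 1 of Algorithm 25, "choose `g₁ = 1`", is a minimising choice.
[cite: DickPillichshammer2014, Thm. 26] -/
theorem isRCBCStep_zero_iff {N : ℕ} (hN : N.Prime) (z' : Fin 0 → ℤ) (w : ℤ) :
    IsRCBCStep N z' w ↔ w ∈ cbcCandidates N := by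
  refine ⟨fun h => h.1, fun hw => ⟨hw, fun w' hw' => ?_⟩⟩
  rw [figureOfMerit_fin_one_eq_zero hN z' hw, figureOfMerit_fin_one_eq_zero hN z' hw']

/-- **Algorithm 25 with `g₁ = 1`**: for a prime `N` there is, in every dimension `s ≥ 1`, an `R`-CBC
vector with first component `1`, as prescribed by step 1 of Algorithm 25.
[cite: DickPillichshammer2014, Thm. 26] -/
theorem exists_isRCBC_apply_zero_eq_one {N : ℕ} (hN : N.Prime) :
    ∀ s : ℕ, ∃ z : Fin (s + 1) → ℤ, IsRCBC N z ∧ z 0 = 1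
  | 0 => by
      have h1 : (1 : ℤ) ∈ cbcCandidates N := by
        rw [mem_cbcCandidates]
        have := hN.two_le
        omega
      refine ⟨fun _ => 1, ?_, rfl⟩
      rw [isRCBC_succ_iff]
      exact ⟨trivial, (isRCBCStep_zero_iff hN _ 1).mpr h1⟩
  | s + 1 => by
      obtain ⟨z', hz', h0⟩ := exists_isRCBC_apply_zero_eq_one hN s
      have hne : (cbcCandidates N).Nonempty :=
        ⟨1, by rw [mem_cbcCandidates]; have := hN.two_le; omega⟩
      obtain ⟨w, hw, hmin⟩ := Finset.exists_min_image (cbcCandidates N)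
        (fun w => figureOfMerit (Fin.snoc z' w : Fin (s + 2) → ℤ) N) hne
      refine ⟨Fin.snoc z' w, isRCBC_snoc hz' ⟨hw, hmin⟩, ?_⟩
      rw [← Fin.castSucc_zero, Fin.snoc_castSucc, h0]

/-- **Theorem 26** (Joe [56]): let `N` be a prime and `g = (g₁, …, g_s)` be constructed according to
Algorithm 25.  Then `R(g, N) ≤ (N-1)⁻¹ (1 + S_N)^s`, where `S_N = Σ_{h ∈ C*(N)} |h|⁻¹`; since the
initial segments `g^{(d)}` of an `R`-CBC vector are `R`-CBC vectors, this is the printed statement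
"for all `1 ≤ d ≤ s`, `R(g^{(d)}, N) ≤ (N-1)⁻¹ (1 + S_N)^d`" (and `d = 0` is trivial).
[cite: DickPillichshammer2014, Thm. 26] -/
theorem figureOfMerit_le_of_isRCBC {N : ℕ} (hN : N.Prime) :
    ∀ {s : ℕ} {z : Fin s → ℤ}, IsRCBC N z →
      figureOfMerit z N ≤ (1 + harmL N) ^ s / ((N : ℝ) - 1)
  | 0, z, _ => by
      have hN1 : (0 : ℝ) < (N : ℝ) - 1 := sub_pos.mpr (by exact_mod_cast hN.one_lt)
      rw [figureOfMerit_fin_zero, pow_zero]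
      positivity
  | s + 1, z, hz => by
      have hN1 : (0 : ℝ) < (N : ℝ) - 1 := sub_pos.mpr (by exact_mod_cast hN.one_lt)
      have hN1' : 1 ≤ N := hN.one_lt.le
      obtain ⟨hz', hstep⟩ := hz
      have IH := figureOfMerit_le_of_isRCBC hN hz'
      have hzs : (Fin.snoc (fun j : Fin s => z j.castSucc) (z (Fin.last s)) : Fin (s + 1) → ℤ) = z :=
        Fin.snoc_init_self z
      -- `Θ(g'; g_d) ≤ (N-1)⁻¹ Σ_z Θ(g'; z) ≤ (N-1)⁻¹ S_N (1 + S_N)^d`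
      have hθb : rTheta N (fun j : Fin s => z j.castSucc) (z (Fin.last s)) ≤
          (harmL N * (1 + harmL N) ^ s) / ((N : ℝ) - 1) := by
        have h1 : ∀ w' ∈ cbcCandidates N, rTheta N (fun j : Fin s => z j.castSucc) (z (Fin.last s)) ≤
            rTheta N (fun j : Fin s => z j.castSucc) w' := fun w' hw' =>
          rTheta_le_of_isRCBCStep hN1' hstep hw'
        have h2 := Finset.card_nsmul_le_sum (cbcCandidates N) _ _ h1
        rw [card_cbcCandidates, nsmul_eq_mul, Nat.cast_sub hN.one_lt.le, Nat.cast_one] at h2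
        have h3 := sum_rTheta_le hN (fun j : Fin s => z j.castSucc)
        rw [le_div_iff₀ hN1]
        linarith
      calc figureOfMerit z N
          = figureOfMerit (fun j : Fin s => z j.castSucc) N +
              rTheta N (fun j : Fin s => z j.castSucc) (z (Fin.last s)) := by
            rw [← figureOfMerit_snoc hN1', hzs]
        _ ≤ (1 + harmL N) ^ s / ((N : ℝ) - 1) + (harmL N * (1 + harmL N) ^ s) / ((N : ℝ) - 1) :=
            add_le_add IH hθb
        _ = (1 + harmL N) ^ (s + 1) / ((N : ℝ) - 1) := by
            rw [pow_succ]
            ring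

/-- **Theorem 26 with `S_N < 2 log N`** (the estimate of Niederreiter [76, Lemmas 1 and 2] quoted
before Corollary 27; `harmL_lt`): for a prime `N` and `g` constructed by Algorithm 25,
`R(g, N) ≤ (N-1)⁻¹ (1 + 2 log N)^s`, i.e. `R(g, N) = O(N⁻¹ (log N)^s)`, the best possible order of
magnitude (Theorem 24). [cite: DickPillichshammer2014, Thm. 26] -/
theorem figureOfMerit_le_log_of_isRCBC {N : ℕ} (hN : N.Prime) {s : ℕ} {z : Fin s → ℤ}
    (hz : IsRCBC N z) :
    figureOfMerit z N ≤ (1 + 2 * Real.log N) ^ s / ((N : ℝ) - 1) := by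
  have hN1 : (0 : ℝ) < (N : ℝ) - 1 := sub_pos.mpr (by exact_mod_cast hN.one_lt)
  have hL : 0 ≤ harmL N := sum_nonneg fun _ _ => inv_nonneg.2 (abs_nonneg _)
  have hlt := harmL_lt N hN.two_le
  refine (figureOfMerit_le_of_isRCBC hN hz).trans ?_
  refine div_le_div_of_nonneg_right ?_ hN1.le
  exact pow_le_pow_left₀ (by positivity) (by linarith) s

/-- **Existence form of Theorem 26**: for every prime `N` and every `s ≥ 1` there is a lattice point
`g ∈ {1, …, N-1}^s` with `g₁ = 1` (namely the output of Algorithm 25) such that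
`R(g, N) ≤ (N-1)⁻¹ (1 + S_N)^s ≤ (N-1)⁻¹ (1 + 2 log N)^s`. [cite: DickPillichshammer2014, Thm. 26] -/
theorem exists_figureOfMerit_le {N : ℕ} (hN : N.Prime) (s : ℕ) :
    ∃ z : Fin (s + 1) → ℤ, (∀ i, z i ∈ cbcCandidates N) ∧ z 0 = 1 ∧
      figureOfMerit z N ≤ (1 + harmL N) ^ (s + 1) / ((N : ℝ) - 1) ∧
      figureOfMerit z N ≤ (1 + 2 * Real.log N) ^ (s + 1) / ((N : ℝ) - 1) := by
  obtain ⟨z, hz, h0⟩ := exists_isRCBC_apply_zero_eq_one hN s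
  exact ⟨z, hz.mem_cbcCandidates, h0, figureOfMerit_le_of_isRCBC hN hz,
    figureOfMerit_le_log_of_isRCBC hN hz⟩

/-! ### Formula (9.34): `R(g, N)` as a character sum -/

section CharacterSum

variable {d : Type*} [Fintype d] [DecidableEq d]

/-- `1 + R(g, N) = Σ_{𝐡 ∈ C_d(N) ∩ L_{g,N}} r(𝐡)⁻¹` for `N ≥ 1` (the term `𝐡 = 0` contributes
`r(0)⁻¹ = 1`). [cite: DickPillichshammer2014, eq. (9.34)] -/
theorem one_add_figureOfMerit_eq_sum (g : d → ℤ) {N : ℕ} (hN : 1 ≤ N) :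
    1 + figureOfMerit g N =
      ∑ h ∈ (centeredBox d N).filter (· ∈ dualLattice N g), (rWeight h)⁻¹ := by
  classical
  have h0 : (0 : d → ℤ) ∈ (centeredBox d N).filter (· ∈ dualLattice N g) := by
    refine mem_filter.mpr ⟨mem_centeredBox.mpr fun j => zero_mem_centeredResidues hN, ?_⟩
    exact (dualLattice N g).zero_mem
  rw [← add_sum_erase _ _ h0]
  have e0 : (rWeight (0 : d → ℤ))⁻¹ = 1 := by simp [rWeight]
  rw [e0, figureOfMerit]
  congr 1
  apply sum_congr
  · ext h
    simp only [mem_erase, mem_filter, ne_eq]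
    tauto
  · intro _ _
    rfl

/-- An additive character turns finite sums into products. [folklore] -/
private theorem AddChar.map_finset_sum' {A M ι : Type*} [AddCommMonoid A] [CommMonoid M]
    (ψ : AddChar A M) (s : Finset ι) (a : ι → A) :
    ψ (∑ i ∈ s, a i) = ∏ i ∈ s, ψ (a i) := by
  classical
  induction s using Finset.induction_on with
  | empty => simp [AddChar.map_zero_eq_one]
  | insert i s hi ih => rw [sum_insert hi, prod_insert hi, AddChar.map_add_eq_mul, ih]

/-- Reindexing a sum over `ℤ/Nℤ` by the representatives `0, …, N-1`. [folklore] -/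
private theorem sum_range_natCast_eq_sum_univ {N : ℕ} [NeZero N] {M : Type*} [AddCommMonoid M]
    (f : ZMod N → M) : ∑ n ∈ range N, f (n : ZMod N) = ∑ x : ZMod N, f x := by
  refine sum_nbij' (fun n : ℕ => (n : ZMod N)) (fun x : ZMod N => x.val) (fun _ _ => mem_univ _)
    (fun x _ => mem_range.mpr (ZMod.val_lt x)) (fun n hn => ?_) (fun x _ => ?_) (fun _ _ => rfl)
  · exact ZMod.val_cast_of_lt (mem_range.mp hn)
  · exact ZMod.natCast_zmod_val x

/-- **The character property (9.26)** in the form used for (9.34): for `N ≥ 1` and `m ∈ ℤ`,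
`Σ_{n=0}^{N-1} exp(2πi m n/N) = N` if `N ∣ m` and `= 0` otherwise.
[cite: DickPillichshammer2014, eq. (9.34)] -/
theorem sum_range_exp_eq_ite (N : ℕ) [NeZero N] (m : ℤ) :
    ∑ n ∈ range N, Complex.exp (2 * π * Complex.I * ((m : ℂ) * (n : ℂ)) / N) =
      if (N : ℤ) ∣ m then (N : ℂ) else 0 := by
  classical
  have e : ∀ n : ℕ, Complex.exp (2 * π * Complex.I * ((m : ℂ) * (n : ℂ)) / N) =
      ZMod.stdAddChar ((n : ZMod N) * (m : ZMod N)) := by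
    intro n
    have h := ZMod.stdAddChar_coe (N := N) (m * n)
    push_cast at h
    rw [mul_comm ((n : ℕ) : ZMod N), h]
  simp_rw [e]
  rw [sum_range_natCast_eq_sum_univ (fun x : ZMod N => (ZMod.stdAddChar (x * (m : ZMod N)) : ℂ)),
    AddChar.sum_mulShift _ (ZMod.isPrimitive_stdAddChar N), ZMod.card]
  by_cases hd : (N : ℤ) ∣ m
  · rw [if_pos ((ZMod.intCast_zmod_eq_zero_iff_dvd m N).mpr hd), if_pos hd]
  · rw [if_neg (fun h => hd ((ZMod.intCast_zmod_eq_zero_iff_dvd m N).mp h)), if_neg hd, Nat.cast_zero]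

/-- **Formula (9.34)** for `1 + R(g, N)`: for `N ≥ 1`,
`1 + R(g, N) = (1/N) Σ_{n=0}^{N-1} ∏ᵢ (1 + Σ_{h ∈ C*(N)} exp(2πi h n gᵢ/N)/|h|)` — expand the product
over `C_d(N)` (the factor for `h = 0` being the `1`) and use (9.26).
[cite: DickPillichshammer2014, eq. (9.34)] -/
theorem one_add_figureOfMerit_eq_characterSum (g : d → ℤ) (N : ℕ) [NeZero N] :
    ((1 + figureOfMerit g N : ℝ) : ℂ) =
      (N : ℂ)⁻¹ * ∑ n ∈ range N, ∏ i,
        (1 + ∑ h ∈ (centeredResidues N).filter (· ≠ 0),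
          Complex.exp (2 * π * Complex.I * ((h : ℂ) * (n : ℂ) * (g i : ℂ)) / N) / ((|h| : ℤ) : ℂ)) := by
  classical
  have hN : 1 ≤ N := Nat.one_le_iff_ne_zero.mpr (NeZero.ne N)
  have hN0 : (N : ℂ) ≠ 0 := by exact_mod_cast NeZero.ne N
  have h0 : (0 : ℤ) ∈ centeredResidues N := zero_mem_centeredResidues hN
  -- the weight `c(h) = r(h)⁻¹ = max(1,|h|)⁻¹`, as a complex number
  set c : ℤ → ℂ := fun h => (((max 1 |(h : ℝ)| : ℝ)⁻¹ : ℝ) : ℂ) with hc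
  -- Step 1: each factor is a full sum over `C(N)`
  have step1 : ∀ (n : ℕ) (i : d),
      (1 + ∑ h ∈ (centeredResidues N).filter (· ≠ 0),
          Complex.exp (2 * π * Complex.I * ((h : ℂ) * (n : ℂ) * (g i : ℂ)) / N) / ((|h| : ℤ) : ℂ)) =
        ∑ h ∈ centeredResidues N,
          c h * Complex.exp (2 * π * Complex.I * ((h : ℂ) * (n : ℂ) * (g i : ℂ)) / N) := by
    intro n i
    rw [← add_sum_erase _ _ h0, ← filter_ne']
    congr 1
    · simp [hc]
    · refine sum_congr rfl fun h hh => ?_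
      have hne : h ≠ 0 := (mem_filter.mp hh).2
      have h1 : (1 : ℝ) ≤ |(h : ℝ)| := by exact_mod_cast Int.one_le_abs hne
      have e : c h = (((|h| : ℤ) : ℂ))⁻¹ := by
        simp only [hc, max_eq_right h1, Complex.ofReal_inv]
        rw [← Complex.ofReal_intCast, Int.cast_abs]
      rw [e, div_eq_inv_mul]
  simp_rw [step1]
  -- Step 2: expand the product over `i` into a sum over `C_d(N)`
  have step2 : ∀ n : ℕ,
      ∏ i, ∑ h ∈ centeredResidues N,
          c h * Complex.exp (2 * π * Complex.I * ((h : ℂ) * (n : ℂ) * (g i : ℂ)) / N) =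
        ∑ p ∈ centeredBox d N, ((rWeight p)⁻¹ : ℝ) *
          Complex.exp (2 * π * Complex.I * (((∑ i, p i * g i : ℤ) : ℂ) * (n : ℂ)) / N) := by
    intro n
    rw [centeredBox, prod_univ_sum]
    refine sum_congr rfl fun p _ => ?_
    rw [prod_mul_distrib, ← Complex.exp_sum]
    congr 1
    · rw [rWeight, ← Finset.prod_inv_distrib, Complex.ofReal_prod]
    · congr 1
      rw [Int.cast_sum, Finset.sum_mul, Finset.mul_sum, Finset.sum_div]
      refine sum_congr rfl fun i _ => ?_
      push_cast
      ring
  simp_rw [step2]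
  -- Step 3: interchange the sums and evaluate the character sums by (9.26)
  rw [sum_comm]
  have step3 : ∀ p ∈ centeredBox d N,
      ∑ n ∈ range N, ((rWeight p)⁻¹ : ℝ) *
          Complex.exp (2 * π * Complex.I * (((∑ i, p i * g i : ℤ) : ℂ) * (n : ℂ)) / N) =
        if p ∈ dualLattice N g then (((rWeight p)⁻¹ : ℝ) : ℂ) * N else 0 := by
    intro p _
    rw [← mul_sum, sum_range_exp_eq_ite N]
    by_cases hp : p ∈ dualLattice N g
    · rw [if_pos hp, if_pos (mem_dualLattice.mp hp)]
    · rw [if_neg hp, if_neg (fun h => hp (mem_dualLattice.mpr h)), mul_zero]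
  rw [sum_congr rfl step3, ← sum_filter, mul_sum, one_add_figureOfMerit_eq_sum g hN,
    Complex.ofReal_sum]
  refine sum_congr rfl fun p _ => ?_
  field_simp

/-- **Formula (9.34)** [cite: DickPillichshammer2014, eq. (9.34)]: for `N ≥ 1`,
`R(g, N) = -1 + (1/N) Σ_{n=0}^{N-1} ∏_{i=1}^s (1 + Σ_{h ∈ C*(N)} exp(2πi h n gᵢ/N)/|h|)`,
"and hence its calculation requires `O(N² s)` operations". -/
theorem figureOfMerit_eq_characterSum (g : d → ℤ) (N : ℕ) [NeZero N] :
    ((figureOfMerit g N : ℝ) : ℂ) =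
      -1 + (N : ℂ)⁻¹ * ∑ n ∈ range N, ∏ i,
        (1 + ∑ h ∈ (centeredResidues N).filter (· ≠ 0),
          Complex.exp (2 * π * Complex.I * ((h : ℂ) * (n : ℂ) * (g i : ℂ)) / N) / ((|h| : ℤ) : ℂ)) := by
  rw [← one_add_figureOfMerit_eq_characterSum g N]
  push_cast
  ring

end CharacterSum

end Literature.Analysis.Quadrature

end
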